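import Mathlib
import HarnessLib
import Summits.NavierStokesRegularity.NavierStokesRegularity.Theorems.UnthreadedRigidityDoorUnthreadedRigidityProfileHornDefs

/-!
# Route `UnthreadedRigidityDoor`, item `UnthreadedRigidity` (W2, stmt-NavierStokesRegularity-27585) — LINE g10-2 «PROFILE HORN»:
# THEOREM PHR, file 1/3 — the profile in the variable `ρ` (`H = h(ρ²)`), LEMMAS J2/J4 as derivatives, decay bounds

Prover file (W2 Lean hand ns-crc-p1 g7, keyed by DIRECTOR-NS dss_128 / KEY-NS #184; `--supports stmt-NavierStokesRegularity-27585 --as helper`)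
for LINE g10-2 «PROFILE HORN» of planner ns-idea-6 g10 on the wall item `UnthreadedRigidity` (route `UnthreadedRigidityDoor`, W2;
idea-crit-4 g6 PASS 2026-08-29T01:30:55Z; sketch `pub/ideators/ns-idea-6/lines/UnthreadedRigidityDoor/ProfileHorn_sketch.lean` sha16
916bdf9b3eac7d48; objects and statements BY NAME in `Theorems/UnthreadedRigidityDoorUnthreadedRigidityProfileHornDefs.lean`).

Part A: for an admissible profile (`HornAdmissible`: `H(r) = h(r²)` on `[0,∞)`, `h ∈ C^∞`) the tree quantities `vortAmp`, `strainAmp`,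
`aTwo`, `aFour` are, on `(0,∞)`, explicit SINGULARITY-FREE polynomials in `ρ², h(ρ²), h′(ρ²), h″(ρ²)`:
`K = 14h′ + 4ρ²h″`, `α = 2ρ²h′ + 3h`, `a₂ = (24/7)(4ρ²h′² + 42hh′ + 12ρ²hh″ − 8ρ⁴h′h″)`, `a₄ = 8(52h′² − 12hh″ + 8ρ²h′h″)`;
LEMMA J2 `ρ a₂ = −(12/7) G₂′` (`G₂ = ρ²H′² − 6ρHH′ − 15H² = 4ρ⁴h′² − 12ρ²hh′ − 15h²`) and LEMMA J4
`ρ a₄ = (8F₄)′ + 480 ρ h′(ρ²)²` (`F₄ = H′²/2 − 3HH′/ρ = 2ρ²h′² − 6hh′`, `480ρh′(ρ²)² = 120 H′²/ρ`) as `HasDerivAt` facts on all of `ℝ`.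
Part B: the decay clause `r⁵|H|, r⁶|H′|, r⁷|H″| ≤ C` on `[1,∞)` gives `|ρa₂| ≤ (576/7)C²/ρ²`, `|ρa₄| ≤ 152C²/ρ²`, `|G₂| ≤ 22C²/ρ`,
`|F₄| ≤ 4C²/ρ`, `H′²/(4ρ) ≤ C²/ρ²` (every pressure integral of the bracket converges).

HONEST LABEL: one-dimensional real analysis about the radial profile of SPECIAL (separable `l = 2`) slice data; it is a piece of a LINE on
the wall item, not the item: `UnthreadedRigidity` (27585), W2 and NS regularity remain OPEN; nothing here is a statement about the
Navier–Stokes equations.  0 kit.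
-/

-- the summit and its single sub-problem share the name (CONVENTIONS §1), as in every Theorems file
set_option linter.dupNamespace false

namespace Summit.NavierStokesRegularity.NavierStokesRegularity.Theorems.UnthreadedRigidity.ProfileHorn

open scoped Topology
open Filter Set MeasureTheory

/-! ## Part A — the profile in the variable `ρ` (`H = h(ρ²)` on `[0,∞)`): model derivatives -/

section Model

variable {h H : ℝ → ℝ}

/-- `d/dρ h(ρ²) = 2ρ h′(ρ²)`. -/
theorem hasDerivAt_comp_sq (hd : Differentiable ℝ h) (ρ : ℝ) :
    HasDerivAt (fun x => h (x ^ 2)) (2 * ρ * deriv h (ρ ^ 2)) ρ := by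
  have h1 : HasDerivAt (fun x : ℝ => x ^ 2) (2 * ρ) ρ := by
    simpa using hasDerivAt_pow 2 ρ
  have h2 : HasDerivAt h (deriv h (ρ ^ 2)) (ρ ^ 2) := (hd _).hasDerivAt
  have h3 := HasDerivAt.comp (h₂ := h) (h := fun x : ℝ => x ^ 2) ρ h2 h1
  refine (h3.congr_of_eventuallyEq (Eventually.of_forall fun x => rfl)).congr_deriv ?_
  ring

/-- `d/dρ (2ρ h′(ρ²)) = 2h′(ρ²) + 4ρ² h″(ρ²)`. -/
theorem hasDerivAt_model_deriv (hd2 : Differentiable ℝ (deriv h)) (ρ : ℝ) :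
    HasDerivAt (fun x => 2 * x * deriv h (x ^ 2))
      (2 * deriv h (ρ ^ 2) + 4 * ρ ^ 2 * deriv (deriv h) (ρ ^ 2)) ρ := by
  have h1 : HasDerivAt (fun x : ℝ => 2 * x) 2 ρ := by
    simpa using (hasDerivAt_id ρ).const_mul (2 : ℝ)
  have h2 : HasDerivAt (fun x => deriv h (x ^ 2)) (2 * ρ * deriv (deriv h) (ρ ^ 2)) ρ :=
    hasDerivAt_comp_sq hd2 ρ
  have h3 := h1.fun_mul h2
  refine (h3.congr_of_eventuallyEq (Eventually.of_forall fun x => rfl)).congr_deriv ?_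
  ring

/-- On `(0,∞)` the profile agrees with `ρ ↦ h(ρ²)` near every point. -/
theorem eventuallyEq_comp_sq (hH : ∀ r, 0 ≤ r → H r = h (r ^ 2)) {r : ℝ} (hr : 0 < r) :
    H =ᶠ[𝓝 r] fun x => h (x ^ 2) := by
  filter_upwards [Ioi_mem_nhds hr] with x hx using hH x (le_of_lt hx)

/-- `H′(r) = 2r h′(r²)` for `r > 0`. -/
theorem deriv_profile (hd : Differentiable ℝ h) (hH : ∀ r, 0 ≤ r → H r = h (r ^ 2)) {r : ℝ}
    (hr : 0 < r) : deriv H r = 2 * r * deriv h (r ^ 2) := by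
  rw [(eventuallyEq_comp_sq hH hr).deriv_eq]
  exact (hasDerivAt_comp_sq hd r).deriv

/-- `H′` agrees with `ρ ↦ 2ρ h′(ρ²)` near every point of `(0,∞)`. -/
theorem eventuallyEq_deriv_profile (hd : Differentiable ℝ h) (hH : ∀ r, 0 ≤ r → H r = h (r ^ 2))
    {r : ℝ} (hr : 0 < r) : deriv H =ᶠ[𝓝 r] fun x => 2 * x * deriv h (x ^ 2) := by
  filter_upwards [Ioi_mem_nhds hr] with x hx using deriv_profile hd hH hx

/-- `H″(r) = 2h′(r²) + 4r² h″(r²)` for `r > 0`. -/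
theorem deriv_deriv_profile (hd : Differentiable ℝ h) (hd2 : Differentiable ℝ (deriv h))
    (hH : ∀ r, 0 ≤ r → H r = h (r ^ 2)) {r : ℝ} (hr : 0 < r) :
    deriv (deriv H) r = 2 * deriv h (r ^ 2) + 4 * r ^ 2 * deriv (deriv h) (r ^ 2) := by
  rw [(eventuallyEq_deriv_profile hd hH hr).deriv_eq]
  exact (hasDerivAt_model_deriv hd2 r).deriv

/-- The vorticity amplitude in the variable `ρ`: `K(r) = 14 h′(r²) + 4 r² h″(r²)` for `r > 0`. -/
theorem vortAmp_eq (hd : Differentiable ℝ h) (hd2 : Differentiable ℝ (deriv h))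
    (hH : ∀ r, 0 ≤ r → H r = h (r ^ 2)) {r : ℝ} (hr : 0 < r) :
    vortAmp H r = 14 * deriv h (r ^ 2) + 4 * r ^ 2 * deriv (deriv h) (r ^ 2) := by
  unfold vortAmp
  rw [deriv_deriv_profile hd hd2 hH hr, deriv_profile hd hH hr]
  field_simp
  ring

/-- The strain amplitude in the variable `ρ`: `α(r) = 2r² h′(r²) + 3 h(r²)` for `r > 0`. -/
theorem strainAmp_eq (hd : Differentiable ℝ h) (hH : ∀ r, 0 ≤ r → H r = h (r ^ 2)) {r : ℝ}
    (hr : 0 < r) : strainAmp H r = 2 * r ^ 2 * deriv h (r ^ 2) + 3 * h (r ^ 2) := by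
  unfold strainAmp
  rw [deriv_profile hd hH hr, hH r hr.le]
  ring

/-- The quadrupole source in the variable `ρ` (no singularity at `ρ = 0`):
`a₂(ρ) = (24/7)(4ρ²h′² + 42 h h′ + 12ρ² h h″ − 8ρ⁴ h′h″)`, `h, h′, h″` at `ρ²`, for `ρ > 0`. -/
theorem aTwo_eq (hd : Differentiable ℝ h) (hd2 : Differentiable ℝ (deriv h))
    (hH : ∀ r, 0 ≤ r → H r = h (r ^ 2)) {ρ : ℝ} (hρ : 0 < ρ) :
    aTwo H ρ = 24 / 7 * (4 * ρ ^ 2 * deriv h (ρ ^ 2) ^ 2 + 42 * h (ρ ^ 2) * deriv h (ρ ^ 2)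
      + 12 * ρ ^ 2 * h (ρ ^ 2) * deriv (deriv h) (ρ ^ 2)
      - 8 * ρ ^ 4 * deriv h (ρ ^ 2) * deriv (deriv h) (ρ ^ 2)) := by
  unfold aTwo
  rw [deriv_deriv_profile hd hd2 hH hρ, deriv_profile hd hH hρ, hH ρ hρ.le]
  field_simp
  ring

/-- The hexadecapole source in the variable `ρ` (no singularity at `ρ = 0`):
`a₄(ρ) = 8(52 h′² − 12 h h″ + 8ρ² h′h″)`, `h, h′, h″` at `ρ²`, for `ρ > 0`. -/
theorem aFour_eq (hd : Differentiable ℝ h) (hd2 : Differentiable ℝ (deriv h))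
    (hH : ∀ r, 0 ≤ r → H r = h (r ^ 2)) {ρ : ℝ} (hρ : 0 < ρ) :
    aFour H ρ = 8 * (52 * deriv h (ρ ^ 2) ^ 2 - 12 * h (ρ ^ 2) * deriv (deriv h) (ρ ^ 2)
      + 8 * ρ ^ 2 * deriv h (ρ ^ 2) * deriv (deriv h) (ρ ^ 2)) := by
  unfold aFour
  rw [deriv_deriv_profile hd hd2 hH hρ, deriv_profile hd hH hρ, hH ρ hρ.le]
  field_simp
  ring

/-- LEMMA J2 (model form, valid on all of `ℝ`): with `G₂(ρ) = 4ρ⁴h′² − 12ρ² h h′ − 15 h²` (`= ρ²H′² − 6ρHH′ − 15H²`),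
`d/dρ (−(12/7) G₂) = ρ · a₂(ρ)`. -/
theorem hasDerivAt_G2 (hd : Differentiable ℝ h) (hd2 : Differentiable ℝ (deriv h)) (ρ : ℝ) :
    HasDerivAt (fun x => -(12 / 7 : ℝ) * (4 * x ^ 4 * deriv h (x ^ 2) ^ 2
        - 12 * x ^ 2 * h (x ^ 2) * deriv h (x ^ 2) - 15 * h (x ^ 2) ^ 2))
      (ρ * (24 / 7 * (4 * ρ ^ 2 * deriv h (ρ ^ 2) ^ 2 + 42 * h (ρ ^ 2) * deriv h (ρ ^ 2)
        + 12 * ρ ^ 2 * h (ρ ^ 2) * deriv (deriv h) (ρ ^ 2)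
        - 8 * ρ ^ 4 * deriv h (ρ ^ 2) * deriv (deriv h) (ρ ^ 2)))) ρ := by
  have e0 : HasDerivAt (fun x => h (x ^ 2)) (2 * ρ * deriv h (ρ ^ 2)) ρ := hasDerivAt_comp_sq hd ρ
  have e1 : HasDerivAt (fun x => deriv h (x ^ 2)) (2 * ρ * deriv (deriv h) (ρ ^ 2)) ρ :=
    hasDerivAt_comp_sq hd2 ρ
  have e4 : HasDerivAt (fun x : ℝ => x ^ 4) (4 * ρ ^ 3) ρ := by simpa using hasDerivAt_pow 4 ρ
  have e2 : HasDerivAt (fun x : ℝ => x ^ 2) (2 * ρ) ρ := by simpa using hasDerivAt_pow 2 ρ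
  have t1 := (e4.const_mul (4 : ℝ)).fun_mul (e1.fun_pow 2)
  have t2 := ((e2.const_mul (12 : ℝ)).fun_mul e0).fun_mul e1
  have t3 := (e0.fun_pow 2).const_mul (15 : ℝ)
  have key := ((t1.fun_sub t2).fun_sub t3).const_mul (-(12 / 7 : ℝ))
  refine (key.congr_of_eventuallyEq (Eventually.of_forall fun x => rfl)).congr_deriv ?_
  push_cast; ring

/-- LEMMA J4 (model form, valid on all of `ℝ`): with `F₄(ρ) = 2ρ²h′² − 6 h h′` (`= H′²/2 − 3HH′/ρ`),
`d/dρ (8 F₄) = ρ · a₄(ρ) − 480 ρ h′(ρ²)²` (`480 ρ h′² = 120 H′²/ρ`). -/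
theorem hasDerivAt_F4 (hd : Differentiable ℝ h) (hd2 : Differentiable ℝ (deriv h)) (ρ : ℝ) :
    HasDerivAt (fun x => (8 : ℝ) * (2 * x ^ 2 * deriv h (x ^ 2) ^ 2 - 6 * h (x ^ 2) * deriv h (x ^ 2)))
      (ρ * (8 * (52 * deriv h (ρ ^ 2) ^ 2 - 12 * h (ρ ^ 2) * deriv (deriv h) (ρ ^ 2)
        + 8 * ρ ^ 2 * deriv h (ρ ^ 2) * deriv (deriv h) (ρ ^ 2))) - 480 * (ρ * deriv h (ρ ^ 2) ^ 2)) ρ := by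
  have e0 : HasDerivAt (fun x => h (x ^ 2)) (2 * ρ * deriv h (ρ ^ 2)) ρ := hasDerivAt_comp_sq hd ρ
  have e1 : HasDerivAt (fun x => deriv h (x ^ 2)) (2 * ρ * deriv (deriv h) (ρ ^ 2)) ρ :=
    hasDerivAt_comp_sq hd2 ρ
  have e2 : HasDerivAt (fun x : ℝ => x ^ 2) (2 * ρ) ρ := by simpa using hasDerivAt_pow 2 ρ
  have t1 := (e2.const_mul (2 : ℝ)).fun_mul (e1.fun_pow 2)
  have t2 := (e0.const_mul (6 : ℝ)).fun_mul e1
  have key := (t1.fun_sub t2).const_mul (8 : ℝ)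
  refine (key.congr_of_eventuallyEq (Eventually.of_forall fun x => rfl)).congr_deriv ?_
  push_cast; ring

end Model

/-! ## Part B — smoothness bookkeeping, decay bounds, integrability, the moments `J₂`, `J₄` -/

section Smooth

open scoped ContDiff

variable {h : ℝ → ℝ}

/-- a smooth function is differentiable. -/
theorem differentiable_of_smooth (hh : ContDiff ℝ ∞ h) : Differentiable ℝ h :=
  (contDiff_infty_iff_deriv.mp hh).1

/-- the derivative of a smooth function is smooth. -/
theorem smooth_deriv_of_smooth (hh : ContDiff ℝ ∞ h) : ContDiff ℝ ∞ (deriv h) :=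
  (contDiff_infty_iff_deriv.mp hh).2

/-- the derivative of a smooth function is differentiable. -/
theorem differentiable_deriv_of_smooth (hh : ContDiff ℝ ∞ h) : Differentiable ℝ (deriv h) :=
  differentiable_of_smooth (smooth_deriv_of_smooth hh)

/-- the second derivative of a smooth function is continuous. -/
theorem continuous_deriv_deriv_of_smooth (hh : ContDiff ℝ ∞ h) : Continuous (deriv (deriv h)) :=
  (smooth_deriv_of_smooth (smooth_deriv_of_smooth hh)).continuous

/-- continuity of `ρ ↦ g(ρ²)` for continuous `g` -/
theorem continuous_comp_sq {g : ℝ → ℝ} (hg : Continuous g) : Continuous fun x : ℝ => g (x ^ 2) :=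
  hg.comp (continuous_pow 2)

end Smooth

section Decay

variable {h H : ℝ → ℝ} {C : ℝ}

/-- The decay constant is non-negative. -/
theorem decay_const_nonneg
    (hC : ∀ r, 1 ≤ r → r ^ 5 * |H r| ≤ C ∧ r ^ 6 * |deriv H r| ≤ C ∧ r ^ 7 * |deriv (deriv H) r| ≤ C) :
    0 ≤ C :=
  le_trans (by positivity) (hC 1 le_rfl).1

/-- an algebraic squeeze: `|YZ − 3XZ − 2Y² − 18XY| ≤ 24 C²` when `|X|, |Y|, |Z| ≤ C`. -/
theorem abs_bracket_two_le {X Y Z C : ℝ} (hX : |X| ≤ C) (hY : |Y| ≤ C) (hZ : |Z| ≤ C) :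
    |Y * Z - 3 * X * Z - 2 * Y ^ 2 - 18 * X * Y| ≤ 24 * C ^ 2 := by
  obtain ⟨hX1, hX2⟩ := abs_le.mp hX
  obtain ⟨hY1, hY2⟩ := abs_le.mp hY
  obtain ⟨hZ1, hZ2⟩ := abs_le.mp hZ
  rw [abs_le]
  constructor
  · nlinarith [mul_nonneg (sub_nonneg.2 hY2) (sub_nonneg.2 hZ2), mul_nonneg (neg_le_iff_add_nonneg'.mp hY1 |> fun h => h) (neg_le_iff_add_nonneg'.mp hZ1),
      mul_nonneg (sub_nonneg.2 hX2) (neg_le_iff_add_nonneg'.mp hZ1), mul_nonneg (neg_le_iff_add_nonneg'.mp hX1) (sub_nonneg.2 hZ2),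
      mul_nonneg (sub_nonneg.2 hY2) (sub_nonneg.2 hY2), mul_nonneg (neg_le_iff_add_nonneg'.mp hY1) (neg_le_iff_add_nonneg'.mp hY1),
      mul_nonneg (sub_nonneg.2 hX2) (neg_le_iff_add_nonneg'.mp hY1), mul_nonneg (neg_le_iff_add_nonneg'.mp hX1) (sub_nonneg.2 hY2),
      mul_nonneg (sub_nonneg.2 hX2) (sub_nonneg.2 hY2), mul_nonneg (neg_le_iff_add_nonneg'.mp hX1) (neg_le_iff_add_nonneg'.mp hY1),
      mul_nonneg (sub_nonneg.2 hX2) (sub_nonneg.2 hZ2), mul_nonneg (neg_le_iff_add_nonneg'.mp hX1) (neg_le_iff_add_nonneg'.mp hZ1),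
      mul_nonneg (sub_nonneg.2 hY2) (neg_le_iff_add_nonneg'.mp hZ1), mul_nonneg (neg_le_iff_add_nonneg'.mp hY1) (sub_nonneg.2 hZ2)]
  · nlinarith [mul_nonneg (sub_nonneg.2 hY2) (sub_nonneg.2 hZ2), mul_nonneg (neg_le_iff_add_nonneg'.mp hY1) (neg_le_iff_add_nonneg'.mp hZ1),
      mul_nonneg (sub_nonneg.2 hX2) (neg_le_iff_add_nonneg'.mp hZ1), mul_nonneg (neg_le_iff_add_nonneg'.mp hX1) (sub_nonneg.2 hZ2),
      mul_nonneg (sub_nonneg.2 hY2) (sub_nonneg.2 hY2), mul_nonneg (neg_le_iff_add_nonneg'.mp hY1) (neg_le_iff_add_nonneg'.mp hY1),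
      mul_nonneg (sub_nonneg.2 hX2) (neg_le_iff_add_nonneg'.mp hY1), mul_nonneg (neg_le_iff_add_nonneg'.mp hX1) (sub_nonneg.2 hY2),
      mul_nonneg (sub_nonneg.2 hX2) (sub_nonneg.2 hY2), mul_nonneg (neg_le_iff_add_nonneg'.mp hX1) (neg_le_iff_add_nonneg'.mp hY1),
      mul_nonneg (sub_nonneg.2 hX2) (sub_nonneg.2 hZ2), mul_nonneg (neg_le_iff_add_nonneg'.mp hX1) (neg_le_iff_add_nonneg'.mp hZ1),
      mul_nonneg (sub_nonneg.2 hY2) (neg_le_iff_add_nonneg'.mp hZ1), mul_nonneg (neg_le_iff_add_nonneg'.mp hY1) (sub_nonneg.2 hZ2)]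

/-- an algebraic squeeze: `|YZ − 3XZ + 12Y² + 3XY| ≤ 19 C²` when `|X|, |Y|, |Z| ≤ C`. -/
theorem abs_bracket_four_le {X Y Z C : ℝ} (hX : |X| ≤ C) (hY : |Y| ≤ C) (hZ : |Z| ≤ C) :
    |Y * Z - 3 * X * Z + 12 * Y ^ 2 + 3 * X * Y| ≤ 19 * C ^ 2 := by
  obtain ⟨hX1, hX2⟩ := abs_le.mp hX
  obtain ⟨hY1, hY2⟩ := abs_le.mp hY
  obtain ⟨hZ1, hZ2⟩ := abs_le.mp hZ
  rw [abs_le]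
  constructor
  · nlinarith [mul_nonneg (sub_nonneg.2 hY2) (sub_nonneg.2 hZ2), mul_nonneg (neg_le_iff_add_nonneg'.mp hY1) (neg_le_iff_add_nonneg'.mp hZ1),
      mul_nonneg (sub_nonneg.2 hX2) (neg_le_iff_add_nonneg'.mp hZ1), mul_nonneg (neg_le_iff_add_nonneg'.mp hX1) (sub_nonneg.2 hZ2),
      mul_nonneg (sub_nonneg.2 hY2) (sub_nonneg.2 hY2), mul_nonneg (neg_le_iff_add_nonneg'.mp hY1) (neg_le_iff_add_nonneg'.mp hY1),
      mul_nonneg (sub_nonneg.2 hX2) (neg_le_iff_add_nonneg'.mp hY1), mul_nonneg (neg_le_iff_add_nonneg'.mp hX1) (sub_nonneg.2 hY2),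
      mul_nonneg (sub_nonneg.2 hX2) (sub_nonneg.2 hY2), mul_nonneg (neg_le_iff_add_nonneg'.mp hX1) (neg_le_iff_add_nonneg'.mp hY1),
      mul_nonneg (sub_nonneg.2 hX2) (sub_nonneg.2 hZ2), mul_nonneg (neg_le_iff_add_nonneg'.mp hX1) (neg_le_iff_add_nonneg'.mp hZ1),
      mul_nonneg (sub_nonneg.2 hY2) (neg_le_iff_add_nonneg'.mp hZ1), mul_nonneg (neg_le_iff_add_nonneg'.mp hY1) (sub_nonneg.2 hZ2),
      mul_nonneg (sub_nonneg.2 hY2) (neg_le_iff_add_nonneg'.mp hY1)]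
  · nlinarith [mul_nonneg (sub_nonneg.2 hY2) (sub_nonneg.2 hZ2), mul_nonneg (neg_le_iff_add_nonneg'.mp hY1) (neg_le_iff_add_nonneg'.mp hZ1),
      mul_nonneg (sub_nonneg.2 hX2) (neg_le_iff_add_nonneg'.mp hZ1), mul_nonneg (neg_le_iff_add_nonneg'.mp hX1) (sub_nonneg.2 hZ2),
      mul_nonneg (sub_nonneg.2 hY2) (sub_nonneg.2 hY2), mul_nonneg (neg_le_iff_add_nonneg'.mp hY1) (neg_le_iff_add_nonneg'.mp hY1),
      mul_nonneg (sub_nonneg.2 hX2) (neg_le_iff_add_nonneg'.mp hY1), mul_nonneg (neg_le_iff_add_nonneg'.mp hX1) (sub_nonneg.2 hY2),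
      mul_nonneg (sub_nonneg.2 hX2) (sub_nonneg.2 hY2), mul_nonneg (neg_le_iff_add_nonneg'.mp hX1) (neg_le_iff_add_nonneg'.mp hY1),
      mul_nonneg (sub_nonneg.2 hX2) (sub_nonneg.2 hZ2), mul_nonneg (neg_le_iff_add_nonneg'.mp hX1) (neg_le_iff_add_nonneg'.mp hZ1),
      mul_nonneg (sub_nonneg.2 hY2) (neg_le_iff_add_nonneg'.mp hZ1), mul_nonneg (neg_le_iff_add_nonneg'.mp hY1) (sub_nonneg.2 hZ2),
      mul_nonneg (sub_nonneg.2 hY2) (neg_le_iff_add_nonneg'.mp hY1)]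

/-- from `ρ^k |x| ≤ C` (`ρ ≥ 0`): `|ρ^k x| ≤ C` -/
theorem abs_pow_mul_le {ρ x C : ℝ} {k : ℕ} (hρ : 0 ≤ ρ) (hx : ρ ^ k * |x| ≤ C) : |ρ ^ k * x| ≤ C := by
  rwa [abs_mul, abs_of_nonneg (pow_nonneg hρ k)]

/-- DECAY of `ρ a₂(ρ)`: `|ρ a₂(ρ)| ≤ (576/7) C² / ρ²` for `ρ ≥ 1`. -/
theorem abs_mul_aTwo_le
    (hC : ∀ r, 1 ≤ r → r ^ 5 * |H r| ≤ C ∧ r ^ 6 * |deriv H r| ≤ C ∧ r ^ 7 * |deriv (deriv H) r| ≤ C)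
    {ρ : ℝ} (hρ : 1 ≤ ρ) : |ρ * aTwo H ρ| ≤ 576 / 7 * C ^ 2 / ρ ^ 2 := by
  have hρ0 : 0 < ρ := lt_of_lt_of_le one_pos hρ
  obtain ⟨h5, h6, h7⟩ := hC ρ hρ
  have hX := abs_pow_mul_le hρ0.le h5
  have hY := abs_pow_mul_le hρ0.le h6
  have hZ := abs_pow_mul_le hρ0.le h7
  have hb := abs_bracket_two_le hX hY hZ
  have e1 : ρ * aTwo H ρ = -(24 / 7) / ρ ^ 11 * (ρ ^ 6 * deriv H ρ * (ρ ^ 7 * deriv (deriv H) ρ)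
      - 3 * (ρ ^ 5 * H ρ) * (ρ ^ 7 * deriv (deriv H) ρ) - 2 * (ρ ^ 6 * deriv H ρ) ^ 2
      - 18 * (ρ ^ 5 * H ρ) * (ρ ^ 6 * deriv H ρ)) := by
    unfold aTwo
    field_simp
  rw [e1, abs_mul, abs_div, abs_neg, abs_of_pos (by norm_num : (0:ℝ) < 24 / 7),
    abs_of_pos (pow_pos hρ0 11)]
  have hρ2 : ρ ^ 2 ≤ ρ ^ 11 := pow_le_pow_right₀ hρ (by norm_num)
  have hC0 : 0 ≤ C := decay_const_nonneg hC
  rw [div_mul_eq_mul_div, div_le_div_iff₀ (pow_pos hρ0 11) (pow_pos hρ0 2)]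
  calc 24 / 7 * |ρ ^ 6 * deriv H ρ * (ρ ^ 7 * deriv (deriv H) ρ)
      - 3 * (ρ ^ 5 * H ρ) * (ρ ^ 7 * deriv (deriv H) ρ) - 2 * (ρ ^ 6 * deriv H ρ) ^ 2
      - 18 * (ρ ^ 5 * H ρ) * (ρ ^ 6 * deriv H ρ)| * ρ ^ 2
      ≤ 24 / 7 * (24 * C ^ 2) * ρ ^ 11 := by
        apply mul_le_mul _ hρ2 (pow_nonneg hρ0.le 2) (by positivity)
        exact mul_le_mul_of_nonneg_left hb (by norm_num)
    _ = 576 / 7 * C ^ 2 * ρ ^ 11 := by ring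

/-- DECAY of `ρ a₄(ρ)`: `|ρ a₄(ρ)| ≤ 152 C² / ρ²` for `ρ ≥ 1`. -/
theorem abs_mul_aFour_le
    (hC : ∀ r, 1 ≤ r → r ^ 5 * |H r| ≤ C ∧ r ^ 6 * |deriv H r| ≤ C ∧ r ^ 7 * |deriv (deriv H) r| ≤ C)
    {ρ : ℝ} (hρ : 1 ≤ ρ) : |ρ * aFour H ρ| ≤ 152 * C ^ 2 / ρ ^ 2 := by
  have hρ0 : 0 < ρ := lt_of_lt_of_le one_pos hρ
  obtain ⟨h5, h6, h7⟩ := hC ρ hρ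
  have hX := abs_pow_mul_le hρ0.le h5
  have hY := abs_pow_mul_le hρ0.le h6
  have hZ := abs_pow_mul_le hρ0.le h7
  have hb := abs_bracket_four_le hX hY hZ
  have e1 : ρ * aFour H ρ = 8 / ρ ^ 13 * (ρ ^ 6 * deriv H ρ * (ρ ^ 7 * deriv (deriv H) ρ)
      - 3 * (ρ ^ 5 * H ρ) * (ρ ^ 7 * deriv (deriv H) ρ) + 12 * (ρ ^ 6 * deriv H ρ) ^ 2
      + 3 * (ρ ^ 5 * H ρ) * (ρ ^ 6 * deriv H ρ)) := by
    unfold aFour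
    field_simp
  rw [e1, abs_mul, abs_div, abs_of_pos (by norm_num : (0:ℝ) < 8), abs_of_pos (pow_pos hρ0 13)]
  have hρ2 : ρ ^ 2 ≤ ρ ^ 13 := pow_le_pow_right₀ hρ (by norm_num)
  have hC0 : 0 ≤ C := decay_const_nonneg hC
  rw [div_mul_eq_mul_div, div_le_div_iff₀ (pow_pos hρ0 13) (pow_pos hρ0 2)]
  calc 8 * |ρ ^ 6 * deriv H ρ * (ρ ^ 7 * deriv (deriv H) ρ)
      - 3 * (ρ ^ 5 * H ρ) * (ρ ^ 7 * deriv (deriv H) ρ) + 12 * (ρ ^ 6 * deriv H ρ) ^ 2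
      + 3 * (ρ ^ 5 * H ρ) * (ρ ^ 6 * deriv H ρ)| * ρ ^ 2
      ≤ 8 * (19 * C ^ 2) * ρ ^ 13 := by
        apply mul_le_mul _ hρ2 (pow_nonneg hρ0.le 2) (by positivity)
        exact mul_le_mul_of_nonneg_left hb (by norm_num)
    _ = 152 * C ^ 2 * ρ ^ 13 := by ring

/-- DECAY of `G₂ = ρ²H′² − 6ρHH′ − 15H²`: `|G₂(ρ)| ≤ 22 C² / ρ` for `ρ ≥ 1`. -/
theorem abs_G2_le
    (hC : ∀ r, 1 ≤ r → r ^ 5 * |H r| ≤ C ∧ r ^ 6 * |deriv H r| ≤ C ∧ r ^ 7 * |deriv (deriv H) r| ≤ C)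
    {ρ : ℝ} (hρ : 1 ≤ ρ) :
    |ρ ^ 2 * deriv H ρ ^ 2 - 6 * ρ * H ρ * deriv H ρ - 15 * H ρ ^ 2| ≤ 22 * C ^ 2 / ρ := by
  have hρ0 : 0 < ρ := lt_of_lt_of_le one_pos hρ
  obtain ⟨h5, h6, -⟩ := hC ρ hρ
  have hX := abs_pow_mul_le hρ0.le h5
  have hY := abs_pow_mul_le hρ0.le h6
  obtain ⟨hX1, hX2⟩ := abs_le.mp hX
  obtain ⟨hY1, hY2⟩ := abs_le.mp hY
  have hb : |(ρ ^ 6 * deriv H ρ) ^ 2 - 6 * (ρ ^ 5 * H ρ) * (ρ ^ 6 * deriv H ρ) - 15 * (ρ ^ 5 * H ρ) ^ 2|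
      ≤ 22 * C ^ 2 := by
    rw [abs_le]; constructor
    · nlinarith [mul_nonneg (sub_nonneg.2 hX2) (neg_le_iff_add_nonneg'.mp hY1), mul_nonneg (neg_le_iff_add_nonneg'.mp hX1) (sub_nonneg.2 hY2),
        mul_nonneg (sub_nonneg.2 hX2) (sub_nonneg.2 hY2), mul_nonneg (neg_le_iff_add_nonneg'.mp hX1) (neg_le_iff_add_nonneg'.mp hY1),
        mul_nonneg (sub_nonneg.2 hX2) (neg_le_iff_add_nonneg'.mp hX1), mul_nonneg (sub_nonneg.2 hY2) (neg_le_iff_add_nonneg'.mp hY1)]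
    · nlinarith [mul_nonneg (sub_nonneg.2 hX2) (neg_le_iff_add_nonneg'.mp hY1), mul_nonneg (neg_le_iff_add_nonneg'.mp hX1) (sub_nonneg.2 hY2),
        mul_nonneg (sub_nonneg.2 hX2) (sub_nonneg.2 hY2), mul_nonneg (neg_le_iff_add_nonneg'.mp hX1) (neg_le_iff_add_nonneg'.mp hY1),
        mul_nonneg (sub_nonneg.2 hX2) (neg_le_iff_add_nonneg'.mp hX1), mul_nonneg (sub_nonneg.2 hY2) (neg_le_iff_add_nonneg'.mp hY1)]
  have e1 : ρ ^ 2 * deriv H ρ ^ 2 - 6 * ρ * H ρ * deriv H ρ - 15 * H ρ ^ 2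
      = ((ρ ^ 6 * deriv H ρ) ^ 2 - 6 * (ρ ^ 5 * H ρ) * (ρ ^ 6 * deriv H ρ) - 15 * (ρ ^ 5 * H ρ) ^ 2) / ρ ^ 10 := by
    field_simp
  rw [e1, abs_div, abs_of_pos (pow_pos hρ0 10), div_le_div_iff₀ (pow_pos hρ0 10) hρ0]
  have hρ1 : ρ ≤ ρ ^ 10 := le_self_pow₀ hρ (by norm_num)
  have hC0 : 0 ≤ C := decay_const_nonneg hC
  calc |(ρ ^ 6 * deriv H ρ) ^ 2 - 6 * (ρ ^ 5 * H ρ) * (ρ ^ 6 * deriv H ρ) - 15 * (ρ ^ 5 * H ρ) ^ 2| * ρ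
      ≤ 22 * C ^ 2 * ρ ^ 10 := mul_le_mul hb hρ1 hρ0.le (by positivity)

/-- DECAY of `F₄ = H′²/2 − 3HH′/ρ`: `|F₄(ρ)| ≤ 4 C² / ρ` for `ρ ≥ 1`. -/
theorem abs_F4_le
    (hC : ∀ r, 1 ≤ r → r ^ 5 * |H r| ≤ C ∧ r ^ 6 * |deriv H r| ≤ C ∧ r ^ 7 * |deriv (deriv H) r| ≤ C)
    {ρ : ℝ} (hρ : 1 ≤ ρ) :
    |deriv H ρ ^ 2 / 2 - 3 * H ρ * deriv H ρ / ρ| ≤ 4 * C ^ 2 / ρ := by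
  have hρ0 : 0 < ρ := lt_of_lt_of_le one_pos hρ
  obtain ⟨h5, h6, -⟩ := hC ρ hρ
  have hX := abs_pow_mul_le hρ0.le h5
  have hY := abs_pow_mul_le hρ0.le h6
  obtain ⟨hX1, hX2⟩ := abs_le.mp hX
  obtain ⟨hY1, hY2⟩ := abs_le.mp hY
  have hb : |(ρ ^ 6 * deriv H ρ) ^ 2 / 2 - 3 * (ρ ^ 5 * H ρ) * (ρ ^ 6 * deriv H ρ)| ≤ 4 * C ^ 2 := by
    rw [abs_le]; constructor
    · nlinarith [mul_nonneg (sub_nonneg.2 hX2) (neg_le_iff_add_nonneg'.mp hY1), mul_nonneg (neg_le_iff_add_nonneg'.mp hX1) (sub_nonneg.2 hY2),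
        mul_nonneg (sub_nonneg.2 hX2) (sub_nonneg.2 hY2), mul_nonneg (neg_le_iff_add_nonneg'.mp hX1) (neg_le_iff_add_nonneg'.mp hY1),
        mul_nonneg (sub_nonneg.2 hY2) (neg_le_iff_add_nonneg'.mp hY1)]
    · nlinarith [mul_nonneg (sub_nonneg.2 hX2) (neg_le_iff_add_nonneg'.mp hY1), mul_nonneg (neg_le_iff_add_nonneg'.mp hX1) (sub_nonneg.2 hY2),
        mul_nonneg (sub_nonneg.2 hX2) (sub_nonneg.2 hY2), mul_nonneg (neg_le_iff_add_nonneg'.mp hX1) (neg_le_iff_add_nonneg'.mp hY1),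
        mul_nonneg (sub_nonneg.2 hY2) (neg_le_iff_add_nonneg'.mp hY1)]
  have e1 : deriv H ρ ^ 2 / 2 - 3 * H ρ * deriv H ρ / ρ
      = ((ρ ^ 6 * deriv H ρ) ^ 2 / 2 - 3 * (ρ ^ 5 * H ρ) * (ρ ^ 6 * deriv H ρ)) / ρ ^ 12 := by
    field_simp
  rw [e1, abs_div, abs_of_pos (pow_pos hρ0 12), div_le_div_iff₀ (pow_pos hρ0 12) hρ0]
  have hρ1 : ρ ≤ ρ ^ 12 := le_self_pow₀ hρ (by norm_num)
  have hC0 : 0 ≤ C := decay_const_nonneg hC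
  calc |(ρ ^ 6 * deriv H ρ) ^ 2 / 2 - 3 * (ρ ^ 5 * H ρ) * (ρ ^ 6 * deriv H ρ)| * ρ
      ≤ 4 * C ^ 2 * ρ ^ 12 := mul_le_mul hb hρ1 hρ0.le (by positivity)

/-- DECAY of the enstrophy-type integrand `H′²/(4ρ)`: `|deriv H ρ ^ 2 / (4ρ)| ≤ C²/ρ²` for `ρ ≥ 1`. -/
theorem abs_P_le
    (hC : ∀ r, 1 ≤ r → r ^ 5 * |H r| ≤ C ∧ r ^ 6 * |deriv H r| ≤ C ∧ r ^ 7 * |deriv (deriv H) r| ≤ C)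
    {ρ : ℝ} (hρ : 1 ≤ ρ) : |deriv H ρ ^ 2 / (4 * ρ)| ≤ C ^ 2 / ρ ^ 2 := by
  have hρ0 : 0 < ρ := lt_of_lt_of_le one_pos hρ
  obtain ⟨-, h6, -⟩ := hC ρ hρ
  have hY := abs_pow_mul_le hρ0.le h6
  have hC0 : 0 ≤ C := le_trans (abs_nonneg _) hY
  have hb : (ρ ^ 6 * deriv H ρ) ^ 2 ≤ C ^ 2 := by
    have := sq_abs (ρ ^ 6 * deriv H ρ)
    rw [← this]
    exact pow_le_pow_left₀ (abs_nonneg _) hY 2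
  rw [abs_of_nonneg (by positivity), div_le_div_iff₀ (by positivity) (pow_pos hρ0 2)]
  have hρ1 : ρ ^ 2 ≤ 4 * ρ * ρ ^ 12 := by nlinarith [pow_le_pow_right₀ hρ (by norm_num : 2 ≤ 13), pow_pos hρ0 13]
  calc deriv H ρ ^ 2 * ρ ^ 2 ≤ deriv H ρ ^ 2 * (4 * ρ * ρ ^ 12) :=
        mul_le_mul_of_nonneg_left hρ1 (sq_nonneg _)
    _ = (ρ ^ 6 * deriv H ρ) ^ 2 * (4 * ρ) := by ring
    _ ≤ C ^ 2 * (4 * ρ) := mul_le_mul_of_nonneg_right hb (by positivity)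

end Decay

end Summit.NavierStokesRegularity.NavierStokesRegularity.Theorems.UnthreadedRigidity.ProfileHorn
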